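import Mathlib.CategoryTheory.IsomorphismClasses
import Mathlib.CategoryTheory.EssentialImage
import Mathlib.Logic.Function.Basic
import Literature.AlgebraicGeometry.Frobenioids.PreFrobenioidPullbacks
import Literature.AlgebraicGeometry.Frobenioids.BaseFrobeniusSections
import HarnessLib

/-!
# Frobenioids I, Proposition 2.9 (i): a terminal object of `D` yields a base-Frobenius pair — proof

Mochizuki, *The geometry of Frobenioids I*, Kyushu J. Math. **62** (2008), §2, Proposition 2.9 (i),
kurims pp. 53–54 [cite: MochizukiFrdI2008, Prop. 2.9(i) p.53].  Proof-only companion of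
`BaseFrobeniusSections.lean` (statement `PreFrobenioid.PreModelOfTerminal`, by abc-iut-L1-t2).

**The construction** (for the category `C` itself — the printed proof first replaces `C` by a
skeleton; we build the skeletal subcategory `P ⊆ C^pl-bk` directly, so base-triviality and
`Aut`-ampleness are not used).  Fix a Frobenius-trivial `A₀` over the terminal object (Def. 1.3
(i)(a)), with Frobenius endomorphisms `F_{A₀} : ℕ_{≥1} → End(A₀)`.  By Def. 1.3 (i)(c) every
`d ∈ Ob(D)` underlies a pull-back morphism `π_d : B_d → A₀`; taking one `d` per isomorphism class
gives the objects of `P`, and the arrows of `P` are the arrows over `A₀`.  Since `Base(A₀)` is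
terminal, the pull-back property of `π_{d'}` identifies `Hom_P(B_d, B_{d'})` with
`Hom_D(d, d')` (so `P ⥲ D`), and lifts `F_{A₀}(n)` uniquely to base-identity endomorphisms of each
`B_d` ("Prop. 1.11 (iii)"); these are isometric base-isomorphisms, hence of Frobenius type because
`C` is of isotropic type (Prop. 1.4 (i)), and they assemble to the Frobenius-section.

No new definitions (theorems only).
-/

namespace Literature.AlgebraicGeometry.Frobenioids

open CategoryTheory CategoryTheory.Limits

universe w v v' u u'

namespace PreFrobenioid

variable {D : Type u} [Category.{v} D] {Φ : Dᵒᵖ ⥤ CommMonCat.{w}}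
  {C : Type u'} [Category.{v'} C] (F : C ⥤ ElemFrobenioid Φ)

/-! ### Lifting along a pull-back morphism over a base-terminal object -/

/-- Arrows into the domain of a pull-back morphism `s : Y → A₀` with `Base(A₀)` terminal are freely
prescribed by an arrow `t : X → A₀` and a base arrow `g : X_D → Y_D` (the pull-back property of
`s`; the compatibility over `Base(A₀)` is automatic). [cite: MochizukiFrdI2008, Prop. 2.9(i) p.53] -/
theorem existsUnique_hom_of_isPullbackMorphism {X Y A₀ : C} (t : X ⟶ A₀) (s : Y ⟶ A₀)
    (hs : IsPullbackMorphism F s) (hT : IsTerminal (baseObj F A₀))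
    (g : baseObj F X ⟶ baseObj F Y) : ∃! f : X ⟶ Y, f ≫ s = t ∧ Base F f = g := by
  obtain ⟨f, hf⟩ := (hs X).2 ⟨(t, g), hT.hom_ext _ _⟩
  refine ⟨f, ⟨congrArg (fun p : PullbackHomData F s X => p.1.1) hf,
    congrArg (fun p : PullbackHomData F s X => p.1.2) hf⟩, fun f' hf' => (hs X).1 ?_⟩
  rw [hf]
  exact Subtype.ext (Prod.ext hf'.1 hf'.2)

/-- Lifting a base-identity endomorphism `ζ` of `A₀` along a pull-back morphism `s : X → A₀`: there
is a unique base-identity `φ : X → X` with `s ∘ φ = ζ ∘ s`.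
[cite: MochizukiFrdI2008, Prop. 2.9(i) p.54] -/
theorem existsUnique_baseIdentity_lift {X A₀ : C} (s : X ⟶ A₀) (hs : IsPullbackMorphism F s)
    (ζ : A₀ ⟶ A₀) (hζ : IsBaseIdentity F ζ) :
    ∃! φ : X ⟶ X, φ ≫ s = s ≫ ζ ∧ Base F φ = 𝟙 (baseObj F X) := by
  have hcompat : Base F (s ≫ ζ) = 𝟙 (baseObj F X) ≫ Base F s := by
    rw [base_comp, show Base F ζ = 𝟙 _ from hζ, Category.comp_id, Category.id_comp]
  obtain ⟨f, hf⟩ := (hs X).2 ⟨(s ≫ ζ, 𝟙 _), hcompat⟩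
  refine ⟨f, ⟨congrArg (fun p : PullbackHomData F s X => p.1.1) hf,
    congrArg (fun p : PullbackHomData F s X => p.1.2) hf⟩, fun f' hf' => (hs X).1 ?_⟩
  rw [hf]
  exact Subtype.ext (Prod.ext hf'.1 hf'.2)

/-- Properties of the lift `φ` of `existsUnique_baseIdentity_lift` when `ζ` is of Frobenius type of
degree `n` in a Frobenioid of isotropic type: `deg_Fr(φ) = n`, and `φ` is an isometric
base-isomorphism, hence of Frobenius type (Prop. 1.4 (i)). [cite: MochizukiFrdI2008, Prop. 2.9(i) p.54] -/
theorem lift_isFrobeniusType (hF : IsFrobenioid F) (hiso : IsOfIsotropicType F) {X A₀ : C}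
    (s : X ⟶ A₀) (hs : IsPullbackMorphism F s) (ζ : A₀ ⟶ A₀) (hζ : IsFrobeniusType F ζ)
    (φ : X ⟶ X) (hφs : φ ≫ s = s ≫ ζ) (hφb : Base F φ = 𝟙 (baseObj F X)) :
    degFr F φ = degFr F ζ ∧ IsFrobeniusType F φ := by
  have hslin : degFr F s = 1 := (hF.iv_b s hs).2
  have hsiso : Div F s = 1 := (hF.iv_b s hs).1.2
  have hdeg : degFr F φ = degFr F ζ := by
    have h := congrArg (degFr F) hφs
    rwa [degFr_comp, degFr_comp, hslin, mul_one, one_mul] at h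
  refine ⟨hdeg, (isFrobeniusType_iff_of_isIsotropic_codomains F φ fun Y _ => hiso Y).mpr ⟨?_, ?_⟩⟩
  · have h := congrArg (Div F) hφs
    rw [div_comp, div_comp, hsiso, hφb, pull_id, show Div F ζ = 1 from hζ.1.2, map_one, one_pow,
      mul_one, hslin] at h
    show Div F φ = 1
    simpa using h
  · show IsIso (Base F φ)
    rw [hφb]
    infer_instance

/-- The lifts of a base-identity Frobenius monoid `ζ₀ : ℕ_{≥1} → End(A₀)` along a pull-back
morphism `s : X → A₀` assemble to a monoid homomorphism `ℕ_{≥1} → End(X)` (uniqueness of lifts).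
[cite: MochizukiFrdI2008, Prop. 2.9(i) p.54] -/
theorem exists_endHom_lift {X A₀ : C} (s : X ⟶ A₀) (hs : IsPullbackMorphism F s)
    (ζ₀ : ℕ+ →* End A₀) (hζ₀ : ∀ n, IsBaseIdentity F (ζ₀ n)) :
    ∃ ζ : ℕ+ →* End X, ∀ n, (show X ⟶ X from ζ n) ≫ s = s ≫ (show A₀ ⟶ A₀ from ζ₀ n) ∧
      Base F (show X ⟶ X from ζ n) = 𝟙 (baseObj F X) := by
  choose φ hφ huniq using fun n => existsUnique_baseIdentity_lift F s hs (ζ₀ n) (hζ₀ n)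
  refine ⟨{ toFun := φ, map_one' := ?_, map_mul' := ?_ }, fun n => hφ n⟩
  · symm
    refine huniq 1 (𝟙 X) ⟨?_, base_id F X⟩
    rw [map_one, End.one_def, Category.id_comp, Category.comp_id]
  · intro m n
    symm
    refine huniq (m * n) (End.of (φ m) * End.of (φ n)) ⟨?_, ?_⟩
    · rw [End.mul_def, map_mul, End.mul_def, Category.assoc, (hφ m).1, ← Category.assoc, (hφ n).1,
        Category.assoc]
    · rw [End.mul_def, base_comp, (hφ n).2, (hφ m).2, Category.comp_id]

/-! ### Proposition 2.9 (i) -/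

/-- **Prop. 2.9 (i), proved**: if `C` is a Frobenioid of isotropic type [the printed hypotheses
"Frobenius-normalized, base-trivial, `Aut`-ample" are not needed for this part] and the base
category `D` has a terminal object, then `C` is of pre-model type: it admits a base-Frobenius pair
`(P, F)` — `P` = pull-back covers `B_d → A₀` of a Frobenius-trivial `A₀` over the terminal object,
one per isomorphism class of `D`, with the arrows over `A₀`; `F(n)` = the lifts of the Frobenius
endomorphisms of `A₀`. [cite: MochizukiFrdI2008, Prop. 2.9(i) p.53] -/
theorem PreModelOfTerminal_holds : PreModelOfTerminal F := by
  classical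
  intro hF _hnorm _hbt hiso _haut hterm
  obtain ⟨T, ⟨hT⟩⟩ := hterm
  haveI : Nonempty D := ⟨T⟩
  -- a Frobenius-trivial object over the terminal object (Def. 1.3 (i)(a))
  obtain ⟨A₀, ⟨ζ₀, hζ₀⟩, ⟨e₀⟩⟩ := hF.i_a T
  have hT₀ : IsTerminal (baseObj F A₀) := hT.ofIso e₀.symm
  have hζ₀b : ∀ n, IsBaseIdentity F (ζ₀ n) := fun n => (hζ₀ n).2.1
  -- pull-back covers of the objects of `D` (Def. 1.3 (i)(c), essential surjectivity)
  have hcov : ∀ d : D, ∃ (B : C) (π : B ⟶ A₀),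
      IsPullbackMorphism F π ∧ Nonempty (baseObj F B ≅ d) := by
    intro d
    haveI := hF.i_c A₀
    let Y : Over ((wideSubcategoryInclusion (pullbackMorphisms F) ⋙ baseFunctor F).obj ⟨A₀⟩) :=
      Over.mk (hT₀.from d)
    let Xo := (pullbackSliceToBase F A₀).objPreimage Y
    have e : (pullbackSliceToBase F A₀).obj Xo ≅ Y := (pullbackSliceToBase F A₀).objObjPreimageIso Y
    exact ⟨Xo.left.obj, Xo.hom.hom, Xo.hom.property, ⟨(Over.forget _).mapIso e⟩⟩
  choose Bo πo hπo eo using hcov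
  -- one representative per isomorphism class of `D`
  let rep : D → D := fun d => (Quotient.mk (isIsomorphicSetoid D) d).out
  have hrep : ∀ d, Nonempty (rep d ≅ d) := fun d => Quotient.mk_out (s := isIsomorphicSetoid D) d
  have hrep_eq : ∀ d d' : D, Nonempty (d ≅ d') → rep d = rep d' := fun d d' h =>
    congrArg Quotient.out (Quotient.sound (s := isIsomorphicSetoid D) h)
  have hrep_idem : ∀ d, rep (rep d) = rep d := fun d => hrep_eq _ _ (hrep d)
  -- the objects of `P` and their structure arrows to `A₀`
  let Pobj : C → Prop := fun X => ∃ d, Bo (rep d) = X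
  let idx : C → D := fun X => rep (Function.invFun (fun d => Bo (rep d)) X)
  have hidx : ∀ X, Pobj X → Bo (idx X) = X := fun X hX => Function.invFun_eq hX
  have hidx_rep : ∀ X, rep (idx X) = idx X := fun X => hrep_idem _
  let str : ∀ X, Pobj X → (X ⟶ A₀) := fun X hX => eqToHom (hidx X hX).symm ≫ πo (idx X)
  have hstr : ∀ X (hX : Pobj X), IsPullbackMorphism F (str X hX) := fun X hX =>
    IsPullbackMorphism.comp F (isPullbackMorphism_of_isIso F _) (hπo _)
  -- the subcategory `P`
  let P : Presection C :=
    { obj := Pobj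
      hom := fun {X Y} f => ∃ (hX : Pobj X) (hY : Pobj Y), f ≫ str Y hY = str X hX
      obj_of_hom := fun f hf => ⟨hf.1, hf.2.1⟩
      hom_id := fun {X} hX => ⟨hX, hX, Category.id_comp _⟩
      hom_comp := fun {X Y Z} f g hf hg => by
        obtain ⟨hX, hY, hf⟩ := hf
        obtain ⟨hY', hZ, hg⟩ := hg
        exact ⟨hX, hZ, by rw [Category.assoc, hg, hf]⟩ }
  -- lifting the Frobenius endomorphisms of `A₀` to the objects of `P`
  choose ζ hζ using fun X : P.Cat => exists_endHom_lift F (str X.1 X.2) (hstr X.1 X.2) ζ₀ hζ₀b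
  have hζprop : ∀ (X : P.Cat) (n : ℕ+), degFr F (show X.1 ⟶ X.1 from ζ X n) = n ∧
      IsFrobeniusType F (show X.1 ⟶ X.1 from ζ X n) := by
    intro X n
    have h := lift_isFrobeniusType F hF hiso (str X.1 X.2) (hstr X.1 X.2) (ζ₀ n) (hζ₀ n).2.2
      (ζ X n) (hζ X n).1 (hζ X n).2
    exact ⟨h.1.trans (hζ₀ n).1, h.2⟩
  -- uniqueness of arrows over `A₀` with prescribed base (pull-back property, `Base(A₀)` terminal)
  have huniq : ∀ (X Y : P.Cat) (t : X.1 ⟶ A₀) (f f' : X.1 ⟶ Y.1),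
      f ≫ str Y.1 Y.2 = t → f' ≫ str Y.1 Y.2 = t → Base F f = Base F f' → f = f' := by
    intro X Y t f f' hf hf' hb
    obtain ⟨u, -, hu⟩ :=
      existsUnique_hom_of_isPullbackMorphism F t (str Y.1 Y.2) (hstr Y.1 Y.2) hT₀ (Base F f)
    exact (hu f ⟨hf, rfl⟩).trans (hu f' ⟨hf', hb.symm⟩).symm
  -- `P` is a base-section
  have hPB : IsBaseSection F P := by
    refine { hom_pullback := ?_, isSkeleton := ?_, isFrobeniusTrivial := ?_, isEquivalence := ?_ }
    · intro X Y f hf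
      obtain ⟨hX, hY, hf⟩ := hf
      refine IsPullbackMorphism.of_comp F (hstr Y hY) ?_
      rw [hf]
      exact hstr X hX
    · rintro A B ⟨i⟩
      have hA1 : Bo (idx A.1) = A.1 := hidx A.1 A.2
      have hB1 : Bo (idx B.1) = B.1 := hidx B.1 B.2
      have hb : Nonempty (idx A.1 ≅ idx B.1) :=
        ⟨(eo (idx A.1)).some.symm ≪≫ eqToIso (congrArg (baseObj F) hA1) ≪≫
          (baseFunctor F).mapIso (P.ι.mapIso i) ≪≫ eqToIso (congrArg (baseObj F) hB1.symm) ≪≫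
            (eo (idx B.1)).some⟩
      have hidxeq : idx A.1 = idx B.1 := by
        rw [← hidx_rep A.1, ← hidx_rep B.1]
        exact hrep_eq _ _ hb
      apply Subtype.ext
      show A.1 = B.1
      rw [← hA1, ← hB1, hidxeq]
    · intro A hA
      exact ⟨ζ ⟨A, hA⟩, fun n => ⟨(hζprop ⟨A, hA⟩ n).1, (hζ ⟨A, hA⟩ n).2, (hζprop ⟨A, hA⟩ n).2⟩⟩
    · have hfull : (P.toBase F).Full := ⟨fun {X Y} g => by
        obtain ⟨f, ⟨hf1, hf2⟩, -⟩ :=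
          existsUnique_hom_of_isPullbackMorphism F (str X.1 X.2) (str Y.1 Y.2) (hstr Y.1 Y.2) hT₀ g
        exact ⟨⟨f, X.2, Y.2, hf1⟩, hf2⟩⟩
      have hfaith : (P.toBase F).Faithful := ⟨fun {X Y} f f' h => by
        obtain ⟨_, _, hf⟩ := f.2
        obtain ⟨_, _, hf'⟩ := f'.2
        exact Presection.hom_ext P (huniq X Y (str X.1 X.2) f.1 f'.1 hf hf' h)⟩
      have hess : (P.toBase F).EssSurj := ⟨fun d =>
        ⟨⟨Bo (rep d), d, rfl⟩, ⟨(eo (rep d)).some.trans (hrep d).some⟩⟩⟩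
      exact ⟨hfaith, hfull, hess⟩
  -- the Frobenius-section
  let Frn : ℕ+ → End P.ι := fun n =>
    { app := fun X => ζ X n
      naturality := by
        intro X Y f
        obtain ⟨hX, hY, hf⟩ := f.2
        show f.1 ≫ (show Y.1 ⟶ Y.1 from ζ Y n) = (show X.1 ⟶ X.1 from ζ X n) ≫ f.1
        refine huniq X Y (str X.1 X.2 ≫ (show A₀ ⟶ A₀ from ζ₀ n)) _ _ ?_ ?_ ?_
        · rw [Category.assoc, (hζ Y n).1, ← Category.assoc, hf]
        · rw [Category.assoc, hf, (hζ X n).1]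
        · rw [base_comp, base_comp, (hζ Y n).2, (hζ X n).2, Category.comp_id, Category.id_comp] }
  let Fr : ℕ+ →* End P.ι :=
    { toFun := Frn
      map_one' := by
        apply NatTrans.ext
        funext X
        show (show X.1 ⟶ X.1 from ζ X 1) = 𝟙 X.1
        rw [map_one]
        rfl
      map_mul' := by
        intro m n
        apply NatTrans.ext
        funext X
        show (show X.1 ⟶ X.1 from ζ X (m * n)) =
          (show X.1 ⟶ X.1 from ζ X n) ≫ (show X.1 ⟶ X.1 from ζ X m)
        rw [map_mul]
        rfl }
  have hFS : IsFrobeniusSection F P Fr :=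
    { degFr_eq := fun n X => (hζprop X n).1
      isBaseIdentity := fun n X => (hζ X n).2
      isFrobeniusType := fun n X => (hζprop X n).2 }
  exact ⟨P, Fr, hPB, hFS⟩

end PreFrobenioid

end Literature.AlgebraicGeometry.Frobenioids
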